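import Summits.QuantumFields.QCD.Theorems.PauliWegnerSeaChiralOneScaleTrajectoryJensenBridge
import Summits.QuantumFields.QCD.Theorems.PauliWegnerSeaChiralGluonicCompletionDefs

/-!
# Stub `stub_secondMoment_of_fmChiral_two` of line `Sketch`
# (crux `PauliWegnerSea.ChiralGluonicCompletion`, stmt-QuantumFields-17498)

**Jensen bridge, eventual form (`N_f = 2`).**  An eventual `|det|`-weighted FRACTIONAL-moment lower bound
`c₀ e^{−(C₁ a_k n + p log(n+1))} ≤ E₊[X^s]` for the flavour-`f` propagator entry sum
`X = Σ_{a,i,b,j} |G_f((0,a,i),(n e₀,b,j))|` (`0 < s ≤ 2`), valid on all tori `S ≥ L_k` and all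
separations `n ≤ S` eventually in `k`, at the DEGENERATE bare tuple `t_k = m_crit(k) + a_k m / Z_m(k)`,
is an eventual lower bound of the same shape for the `|det|`-weighted SECOND moment `E₊[Σ |G_f|²]` with
rate `μ := 2C₁/s` (`< ε` because `2C₁ < sε`), constant `c := c₀^{2/s}/144 > 0` and log-loss `p' := 2p/s`.

Mechanism, pointwise in `(k, S, n)` and verbatim the sibling crux 17512's
`ChiralOneScaleTrajectory.GoldstoneWitness.unsignedPin_two_of_fmPin` (frequently-form): under the
phase-quenched PROBABILITY measure `|det D| dμ_W / ∫ |det D| dμ_W`,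
`E₊[Σ|G|²] ≥ E₊[X²]/144` (Cauchy–Schwarz over the `144` colour–spin pairs, `sq_sum_four_le`) and
`E₊[X^s] ≤ (E₊[X²])^{s/2}` (Jensen, `qcdPhaseQuenchedExpect_rpow_le_rpow`), so
`c₀ e^{−(…)} ≤ E₊[X^s] ≤ (144 E₊[Σ|G|²])^{s/2}` and raising to the power `2/s`:
`c₀^{2/s} e^{−((2C₁/s) a_k n + (2p/s) log(n+1))} ≤ 144 E₊[Σ|G|²]`.  Finiteness of the second moment is
the `N_f = 2` input: `|det D| · |G_f|² ≤ |adj D_t|²` is bounded on the compact configuration space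
(`norm_det_mul_normSq_inv_le_two`, `integrable_qcdLatticeMeasure_of_weight_bound`).
Sources: folklore (Jensen: Mathlib `ConvexOn.map_integral_le` through the tree's
`qcdPhaseQuenchedExpect_rpow_le_rpow`; Cauchy–Schwarz: Mathlib `sq_sum_le_card_mul_sum_sq`).
-/

noncomputable section

namespace Summit.QuantumFields.QCD.Theorems.StronglyChiralSubsequence

open scoped BigOperators
open MeasureTheory Filter Topology
open Literature.MathematicalPhysics.QuantumFieldTheory Literature.MathematicalPhysics.QuantumLattice
  Literature.Probability.LatticeModels
open Summit.QuantumFields.QCD.Cruxes.ChiralOneScaleTrajectory.GoldstoneWitness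

/-- **Stub E1₂ — Jensen bridge, eventual form (N_f = 2).**  An eventual `|det|`-weighted FRACTIONAL-moment
lower bound `c₀ e^{−(C₁ a_k n + p log(n+1))} ≤ E₊[X^s]` (`X = Σ_{a,i,b,j}|G_f((0,a,i),(ne₀,b,j))|`, `0 < s ≤ 2`, all
`S ≥ L_k`, `n ≤ S`) at the degenerate tuple is an eventual lower bound `c e^{−(μ a_k n + p' log(n+1))} ≤ E₊[Σ|G_f|²]`
for the `|det|`-weighted SECOND moment with `μ = 2C₁/s < ε`, `c = c₀^{2/s}/144 > 0`, `p' = 2p/s`: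
`E₊[Σ|G|²] ≥ E₊[X²]/144 ≥ (E₊[X^s])^{2/s}/144` (Cauchy–Schwarz over the 144 colour–spin pairs, Jensen for
`u ↦ u^{2/s}` under the phase-quenched probability measure `|det D| dμ_W / ∫|det D|`, whose second moment is finite
because `|det D|·|G_f|² ≤ |adj D_t|²` is bounded on the compact configuration space — the `N_f = 2` input).  Pattern:
crux 17512's `ChiralOneScaleTrajectory.GoldstoneWitness.unsignedPin_two_of_fmPin` (frequently-form), made eventual.
[folklore] -/
theorem stub_secondMoment_of_fmChiral_two : ∀ reg : QCDRegularisation 2, (∀ ε : ℝ, 0 < ε → ∃ m : ℝ, 0 < m ∧ ∃ (f : Fin 2) (s c₀ C₁ p : ℝ), 0 < s ∧ s ≤ 2 ∧ 0 < c₀ ∧ 2 * C₁ < s * ε ∧ ∀ᶠ k in atTop, ∀ S : ℕ, reg.L k ≤ S → ∀ n : ℕ, n ≤ S → c₀ * Real.exp (-(C₁ * (reg.a k * n) + p * Real.log (n + 1))) ≤ (∫ U : GaugeConfig 4 (2 * S + 1) (Matrix.specialUnitaryGroup (Fin 3) ℂ), ‖(diracMatrix U fun _ : Fin 2 => reg.mcrit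 k + reg.a k * m / reg.Zm k).det‖ * (∑ a : Fin 3, ∑ i : Fin 4, ∑ b : Fin 3, ∑ j : Fin 4, ‖(diracMatrix U fun _ : Fin 2 => reg.mcrit k + reg.a k * m / reg.Zm k)⁻¹ (quarkEquiv (f, (Torus.proj (2 * S + 1) 0, a, i))) (quarkEquiv (f, (Torus.proj (2 * S + 1) (Pi.single 0 (n : ℤ)), b, j)))‖) ^ s ∂(wilsonMeasure (fundamentalRep (Fin 3)) (reg.β k))) / (∫ U : GaugeConfig 4 (2 * S + 1) (Matrix.specialUnitaryGroup (Fin 3) ℂ), ‖(diracMatrix U fun _ : Fin 2 => reg.mcrit k + reg.a k * m / reg.Zm k).det‖ ∂(wilsonMeasure (fundamentalRep (Fin 3)) (reg.β k)))) → ∀ ε : ℝ, 0 < ε → ∃ m : ℝ, 0 < m ∧ ∃ (f : Fin 2) (μ c p : ℝ), μ < ε ∧ 0 < c ∧ ∀ᶠ k in atTop, ∀ S : ℕ, reg.L k ≤ S → ∀ n : ℕ, n ≤ S → c * Real.exp (-(μ * (reg.a k * n) + p * Real.log (n + 1))) ≤ (∫ U : GaugeConfig 4 (2 * S + 1) (Matrix.specialUnitaryGroup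 (Fin 3) ℂ), ‖(diracMatrix U fun _ : Fin 2 => reg.mcrit k + reg.a k * m / reg.Zm k).det‖ * (∑ a : Fin 3, ∑ i : Fin 4, ∑ b : Fin 3, ∑ j : Fin 4, ‖(diracMatrix U fun _ : Fin 2 => reg.mcrit k + reg.a k * m / reg.Zm k)⁻¹ (quarkEquiv (f, (Torus.proj (2 * S + 1) 0, a, i))) (quarkEquiv (f, (Torus.proj (2 * S + 1) (Pi.single 0 (n : ℤ)), b, j)))‖ ^ (2 : ℕ)) ∂(wilsonMeasure (fundamentalRep (Fin 3)) (reg.β k))) / (∫ U : GaugeConfig 4 (2 * S + 1) (Matrix.specialUnitaryGroup (Fin 3) ℂ), ‖(diracMatrix U fun _ : Fin 2 => reg.mcrit k + reg.a k * m / reg.Zm k).det‖ ∂(wilsonMeasure (fundamentalRep (Fin 3)) (reg.β k))) := by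
  intro reg h ε hε
  obtain ⟨m, hm, f, s, c₀, C₁, p, hs, hs2, hc₀, hC₁, hev⟩ := h ε hε
  refine ⟨m, hm, f, 2 * C₁ / s, c₀ ^ (2 / s) / 144, 2 * p / s, ?_, by positivity, ?_⟩
  · rw [div_lt_iff₀ hs]
    linarith [mul_comm s ε]
  filter_upwards [hev] with k hk S hS n hn
  have hlow := hk S hS n hn
  -- abbreviations at the fixed `k, S, n`
  set t : ℝ := reg.mcrit k + reg.a k * m / reg.Zm k with ht
  set mq : Fin 2 → ℝ := fun _ => t with hmq
  set β : ℝ := reg.β k with hβ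
  set μ := wilsonMeasure (d := 4) (L := 2 * S + 1) (fundamentalRep (Fin 3)) β with hμ
  haveI : IsProbabilityMeasure μ := isProbabilityMeasure_wilsonMeasure _ (continuous_fundamentalRep _) _
  set P : Fin 3 → Fin 4 → FermiIdx 2 (2 * S + 1) := fun a i => quarkEquiv (f, (Torus.proj (2 * S + 1) 0, a, i))
    with hP
  set Q : Fin 3 → Fin 4 → FermiIdx 2 (2 * S + 1) := fun b j =>
    quarkEquiv (f, (Torus.proj (2 * S + 1) (Pi.single 0 (n : ℤ)), b, j)) with hQ
  set G : GaugeConfig 4 (2 * S + 1) SU3 → Fin 3 → Fin 4 → Fin 3 → Fin 4 → ℝ :=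
    fun U a i b j => ‖(diracMatrix U mq)⁻¹ (P a i) (Q b j)‖ with hG
  set Y : GaugeConfig 4 (2 * S + 1) SU3 → ℝ := fun U =>
    ∑ a : Fin 3, ∑ i : Fin 4, ∑ b : Fin 3, ∑ j : Fin 4, G U a i b j with hY
  set Y2 : GaugeConfig 4 (2 * S + 1) SU3 → ℝ := fun U =>
    ∑ a : Fin 3, ∑ i : Fin 4, ∑ b : Fin 3, ∑ j : Fin 4, G U a i b j ^ 2 with hY2
  have hG0 : ∀ U a i b j, 0 ≤ G U a i b j := fun U a i b j => norm_nonneg _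
  have hY0 : ∀ U, 0 ≤ Y U := fun U => Finset.sum_nonneg fun a _ => Finset.sum_nonneg fun i _ =>
    Finset.sum_nonneg fun b _ => Finset.sum_nonneg fun j _ => hG0 U a i b j
  have hY20 : ∀ U, 0 ≤ Y2 U := fun U => Finset.sum_nonneg fun a _ => Finset.sum_nonneg fun i _ =>
    Finset.sum_nonneg fun b _ => Finset.sum_nonneg fun j _ => sq_nonneg _
  -- measurability
  have hGm : ∀ a i b j, Measurable fun U => G U a i b j := fun a i b j =>
    (measurable_inv_diracMatrix_apply mq (P a i) (Q b j)).norm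
  have hYm : Measurable Y := Finset.measurable_sum _ fun a _ => Finset.measurable_sum _ fun i _ =>
    Finset.measurable_sum _ fun b _ => Finset.measurable_sum _ fun j _ => hGm a i b j
  have hY2m : Measurable Y2 := Finset.measurable_sum _ fun a _ => Finset.measurable_sum _ fun i _ =>
    Finset.measurable_sum _ fun b _ => Finset.measurable_sum _ fun j _ => (hGm a i b j).pow_const 2
  -- the uniform weight bound `|det D| · G² ≤ B`
  have hc : Continuous fun U : GaugeConfig 4 (2 * S + 1) SU3 => wilsonDirac (fundamentalRep (Fin 3)) U t 1 :=
    continuous_wilsonDirac _ (continuous_fundamentalRep (Fin 3)) t 1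
  obtain ⟨B, hB⟩ : ∃ B : ℝ, ∀ (U : GaugeConfig 4 (2 * S + 1) SU3) a i b j,
      ‖(diracMatrix U mq).det‖ * G U a i b j ^ 2 ≤ B := by
    have hcont : Continuous fun U : GaugeConfig 4 (2 * S + 1) SU3 =>
        ∑ a : Fin 3, ∑ i : Fin 4, ∑ b : Fin 3, ∑ j : Fin 4,
          ‖(wilsonDirac (fundamentalRep (Fin 3)) U t 1).adjugate (Torus.proj (2 * S + 1) 0, a, i)
            (Torus.proj (2 * S + 1) (Pi.single 0 (n : ℤ)), b, j)‖ ^ 2 := by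
      refine continuous_finsetSum _ fun a _ => continuous_finsetSum _ fun i _ =>
        continuous_finsetSum _ fun b _ => continuous_finsetSum _ fun j _ => ?_
      exact ((hc.matrix_adjugate.matrix_elem _ _).norm).pow 2
    obtain ⟨U₀, -, hU₀⟩ := (isCompact_univ (X := GaugeConfig 4 (2 * S + 1) SU3)).exists_isMaxOn
      Set.univ_nonempty hcont.continuousOn
    refine ⟨∑ a : Fin 3, ∑ i : Fin 4, ∑ b : Fin 3, ∑ j : Fin 4,
          ‖(wilsonDirac (fundamentalRep (Fin 3)) U₀ t 1).adjugate (Torus.proj (2 * S + 1) 0, a, i)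
            (Torus.proj (2 * S + 1) (Pi.single 0 (n : ℤ)), b, j)‖ ^ 2, fun U a i b j => ?_⟩
    refine (norm_det_mul_normSq_inv_le_two U t f _ _).trans ((?_ : _ ≤ _).trans (hU₀ (Set.mem_univ U)))
    -- one term is bounded by the full (non-negative) sum
    have h1 : ∀ a' i' b' j', 0 ≤ ‖(wilsonDirac (fundamentalRep (Fin 3)) U t 1).adjugate
        (Torus.proj (2 * S + 1) 0, a', i') (Torus.proj (2 * S + 1) (Pi.single 0 (n : ℤ)), b', j')‖ ^ 2 :=
      fun _ _ _ _ => sq_nonneg _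
    calc ‖(wilsonDirac (fundamentalRep (Fin 3)) U t 1).adjugate (Torus.proj (2 * S + 1) 0, a, i)
            (Torus.proj (2 * S + 1) (Pi.single 0 (n : ℤ)), b, j)‖ ^ 2
        ≤ ∑ j' : Fin 4, ‖(wilsonDirac (fundamentalRep (Fin 3)) U t 1).adjugate (Torus.proj (2 * S + 1) 0, a, i)
            (Torus.proj (2 * S + 1) (Pi.single 0 (n : ℤ)), b, j')‖ ^ 2 :=
          Finset.single_le_sum (fun j' _ => h1 a i b j') (Finset.mem_univ j)
      _ ≤ ∑ b' : Fin 3, ∑ j' : Fin 4, ‖(wilsonDirac (fundamentalRep (Fin 3)) U t 1).adjugate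
            (Torus.proj (2 * S + 1) 0, a, i) (Torus.proj (2 * S + 1) (Pi.single 0 (n : ℤ)), b', j')‖ ^ 2 :=
          Finset.single_le_sum (fun b' _ => Finset.sum_nonneg fun j' _ => h1 a i b' j') (Finset.mem_univ b)
      _ ≤ ∑ i' : Fin 4, ∑ b' : Fin 3, ∑ j' : Fin 4, ‖(wilsonDirac (fundamentalRep (Fin 3)) U t 1).adjugate
            (Torus.proj (2 * S + 1) 0, a, i') (Torus.proj (2 * S + 1) (Pi.single 0 (n : ℤ)), b', j')‖ ^ 2 :=
          Finset.single_le_sum (fun i' _ => Finset.sum_nonneg fun b' _ => Finset.sum_nonneg fun j' _ =>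
            h1 a i' b' j') (Finset.mem_univ i)
      _ ≤ ∑ a' : Fin 3, ∑ i' : Fin 4, ∑ b' : Fin 3, ∑ j' : Fin 4,
            ‖(wilsonDirac (fundamentalRep (Fin 3)) U t 1).adjugate (Torus.proj (2 * S + 1) 0, a', i')
              (Torus.proj (2 * S + 1) (Pi.single 0 (n : ℤ)), b', j')‖ ^ 2 :=
          Finset.single_le_sum (fun a' _ => Finset.sum_nonneg fun i' _ => Finset.sum_nonneg fun b' _ =>
            Finset.sum_nonneg fun j' _ => h1 a' i' b' j') (Finset.mem_univ a)
  have hB0 : 0 ≤ B := le_trans (by positivity) (hB (TwistedFreeWilson.twistCfg _) 0 0 0 0)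
  -- weight bounds for `Y2`, `Y ^ 2` and `Y ^ s`
  have hwY2 : ∀ U, ‖(diracMatrix U mq).det‖ * Y2 U ≤ 144 * B := by
    intro U
    have : ‖(diracMatrix U mq).det‖ * Y2 U =
        ∑ a : Fin 3, ∑ i : Fin 4, ∑ b : Fin 3, ∑ j : Fin 4, ‖(diracMatrix U mq).det‖ * G U a i b j ^ 2 := by
      simp only [hY2, Finset.mul_sum]
    rw [this]
    calc ∑ a : Fin 3, ∑ i : Fin 4, ∑ b : Fin 3, ∑ j : Fin 4, ‖(diracMatrix U mq).det‖ * G U a i b j ^ 2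
        ≤ ∑ _a : Fin 3, ∑ _i : Fin 4, ∑ _b : Fin 3, ∑ _j : Fin 4, B :=
          Finset.sum_le_sum fun a _ => Finset.sum_le_sum fun i _ => Finset.sum_le_sum fun b _ =>
            Finset.sum_le_sum fun j _ => hB U a i b j
      _ = 144 * B := by simp; ring
  have hYsq : ∀ U, Y U ^ 2 ≤ 144 * Y2 U := fun U => sq_sum_four_le (G U)
  have hwYsq : ∀ U, ‖(diracMatrix U mq).det‖ * Y U ^ 2 ≤ 144 * (144 * B) := fun U =>
    calc ‖(diracMatrix U mq).det‖ * Y U ^ 2 ≤ ‖(diracMatrix U mq).det‖ * (144 * Y2 U) :=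
          mul_le_mul_of_nonneg_left (hYsq U) (norm_nonneg _)
      _ = 144 * (‖(diracMatrix U mq).det‖ * Y2 U) := by ring
      _ ≤ 144 * (144 * B) := by nlinarith [hwY2 U]
  obtain ⟨Bd, hBd⟩ := exists_norm_det_diracMatrix_le (S := 2 * S + 1) mq
  have hwYs : ∀ U, ‖(diracMatrix U mq).det‖ * Y U ^ s ≤ Bd + 144 * (144 * B) := fun U =>
    calc ‖(diracMatrix U mq).det‖ * Y U ^ s ≤ ‖(diracMatrix U mq).det‖ * (1 + Y U ^ 2) :=
          mul_le_mul_of_nonneg_left (rpow_le_one_add_sq (hY0 U) hs hs2) (norm_nonneg _)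
      _ = ‖(diracMatrix U mq).det‖ + ‖(diracMatrix U mq).det‖ * Y U ^ 2 := by ring
      _ ≤ Bd + 144 * (144 * B) := add_le_add (hBd U) (hwYsq U)
  -- integrability under the phase-quenched probability measure (for Jensen)
  have hiYs : Integrable (fun U => Y U ^ s) (qcdLatticeMeasure (2 * S + 1) β mq) :=
    integrable_qcdLatticeMeasure_of_weight_bound β mq _ (hYm.pow_const s) _ fun U => by
      rw [Real.norm_eq_abs, abs_of_nonneg (Real.rpow_nonneg (hY0 U) s)]; exact hwYs U
  have hiY2r : Integrable (fun U => Y U ^ (2 : ℝ)) (qcdLatticeMeasure (2 * S + 1) β mq) := by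
    simp_rw [Real.rpow_two]
    exact integrable_qcdLatticeMeasure_of_weight_bound β mq _ (hYm.pow_const 2) _ fun U => by
      rw [Real.norm_eq_abs, abs_of_nonneg (sq_nonneg _)]; exact hwYsq U
  -- integrability against the Wilson measure with the weight (for monotonicity)
  have hdm := measurable_norm_det_diracMatrix (S := 2 * S + 1) mq
  have hiwYsq : Integrable (fun U => ‖(diracMatrix U mq).det‖ * Y U ^ (2 : ℝ)) μ := by
    simp_rw [Real.rpow_two]
    refine Integrable.of_bound (hdm.mul (hYm.pow_const 2)).aestronglyMeasurable (144 * (144 * B))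
      (Eventually.of_forall fun U => ?_)
    rw [Real.norm_eq_abs, abs_of_nonneg (mul_nonneg (norm_nonneg _) (sq_nonneg _))]
    exact hwYsq U
  have hiwY2 : Integrable (fun U => ‖(diracMatrix U mq).det‖ * (144 * Y2 U)) μ := by
    refine Integrable.of_bound (hdm.mul (hY2m.const_mul 144)).aestronglyMeasurable (144 * (144 * B))
      (Eventually.of_forall fun U => ?_)
    rw [Real.norm_eq_abs, abs_of_nonneg (mul_nonneg (norm_nonneg _) (by nlinarith [hY20 U]))]
    calc ‖(diracMatrix U mq).det‖ * (144 * Y2 U) = 144 * (‖(diracMatrix U mq).det‖ * Y2 U) := by ring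
      _ ≤ 144 * (144 * B) := by nlinarith [hwY2 U]
  -- Jensen and Cauchy–Schwarz in phase-quenched form
  have hZ := integral_norm_det_diracMatrix_pos_all (S := 2 * S + 1) β mq
  have hJ : qcdPhaseQuenchedExpect β (2 * S + 1) mq (fun U => Y U ^ s) ≤
      (qcdPhaseQuenchedExpect β (2 * S + 1) mq (fun U => Y U ^ (2 : ℝ))) ^ (s / 2) :=
    qcdPhaseQuenchedExpect_rpow_le_rpow β mq hZ Y hY0 hs hs2 hiYs hiY2r
  have hCS : qcdPhaseQuenchedExpect β (2 * S + 1) mq (fun U => Y U ^ (2 : ℝ)) ≤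
      qcdPhaseQuenchedExpect β (2 * S + 1) mq (fun U => 144 * Y2 U) :=
    qcdPhaseQuenchedExpect_mono β mq _ _ hiwYsq hiwY2 (Eventually.of_forall fun U => by
      rw [Real.rpow_two]; exact hYsq U)
  have hlin : qcdPhaseQuenchedExpect β (2 * S + 1) mq (fun U => 144 * Y2 U) =
      144 * qcdPhaseQuenchedExpect β (2 * S + 1) mq Y2 := by
    have := qcdPhaseQuenchedExpect_smul β mq (144 : ℝ) Y2
    simp only [smul_eq_mul] at this
    exact this
  have hq2 : 0 ≤ qcdPhaseQuenchedExpect β (2 * S + 1) mq (fun U => Y U ^ (2 : ℝ)) := by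
    rw [qcdPhaseQuenchedExpect_eq_div]
    exact div_nonneg (integral_nonneg fun U => mul_nonneg (norm_nonneg _) (Real.rpow_nonneg (hY0 U) _))
      (integral_nonneg fun U => norm_nonneg _)
  -- the fractional-moment quotient of the hypothesis IS `⟨Y^s⟩₊`, the target quotient IS `⟨Y2⟩₊`
  have hFM : (∫ U, ‖(diracMatrix U mq).det‖ * Y U ^ s ∂μ) / (∫ U, ‖(diracMatrix U mq).det‖ ∂μ) =
      qcdPhaseQuenchedExpect β (2 * S + 1) mq (fun U => Y U ^ s) :=
    (qcdPhaseQuenchedExpect_eq_div β mq _).symm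
  have hQ2 : (∫ U, ‖(diracMatrix U mq).det‖ * Y2 U ∂μ) / (∫ U, ‖(diracMatrix U mq).det‖ ∂μ) =
      qcdPhaseQuenchedExpect β (2 * S + 1) mq Y2 :=
    (qcdPhaseQuenchedExpect_eq_div β mq _).symm
  -- bookkeeping of the constants
  change c₀ ^ (2 / s) / 144 * Real.exp (-(2 * C₁ / s * (reg.a k * n) + 2 * p / s * Real.log (n + 1))) ≤
    (∫ U, ‖(diracMatrix U mq).det‖ * Y2 U ∂μ) / (∫ U, ‖(diracMatrix U mq).det‖ ∂μ)
  change c₀ * Real.exp (-(C₁ * (reg.a k * n) + p * Real.log (n + 1))) ≤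
    (∫ U, ‖(diracMatrix U mq).det‖ * Y U ^ s ∂μ) / (∫ U, ‖(diracMatrix U mq).det‖ ∂μ) at hlow
  rw [hQ2]
  rw [hFM] at hlow
  have hs0 : s ≠ 0 := hs.ne'
  have hL0 : 0 ≤ c₀ * Real.exp (-(C₁ * (reg.a k * n) + p * Real.log (n + 1))) := by positivity
  -- raise `c₀ e^{-(…)} ≤ ⟨Y^s⟩₊ ≤ ⟨Y^2⟩₊^{s/2}` to the power `2/s`
  have h1 : (c₀ * Real.exp (-(C₁ * (reg.a k * n) + p * Real.log (n + 1)))) ^ (2 / s) ≤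
      qcdPhaseQuenchedExpect β (2 * S + 1) mq (fun U => Y U ^ (2 : ℝ)) := by
    calc (c₀ * Real.exp (-(C₁ * (reg.a k * n) + p * Real.log (n + 1)))) ^ (2 / s)
        ≤ ((qcdPhaseQuenchedExpect β (2 * S + 1) mq (fun U => Y U ^ (2 : ℝ))) ^ (s / 2)) ^ (2 / s) :=
          Real.rpow_le_rpow hL0 (hlow.trans hJ) (by positivity)
      _ = qcdPhaseQuenchedExpect β (2 * S + 1) mq (fun U => Y U ^ (2 : ℝ)) := by
          rw [← Real.rpow_mul hq2, show s / 2 * (2 / s) = 1 by field_simp, Real.rpow_one]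
  have h2 : (c₀ * Real.exp (-(C₁ * (reg.a k * n) + p * Real.log (n + 1)))) ^ (2 / s) ≤
      144 * qcdPhaseQuenchedExpect β (2 * S + 1) mq Y2 :=
    h1.trans (hCS.trans_eq hlin)
  have hpow : (c₀ * Real.exp (-(C₁ * (reg.a k * n) + p * Real.log (n + 1)))) ^ (2 / s) =
      c₀ ^ (2 / s) * Real.exp (-(2 * C₁ / s * (reg.a k * n) + 2 * p / s * Real.log (n + 1))) := by
    rw [Real.mul_rpow hc₀.le (Real.exp_pos _).le, ← Real.exp_mul]
    congr 2
    ring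
  rw [hpow] at h2
  calc c₀ ^ (2 / s) / 144 * Real.exp (-(2 * C₁ / s * (reg.a k * n) + 2 * p / s * Real.log (n + 1)))
      = c₀ ^ (2 / s) * Real.exp (-(2 * C₁ / s * (reg.a k * n) + 2 * p / s * Real.log (n + 1))) / 144 := by
        ring
    _ ≤ qcdPhaseQuenchedExpect β (2 * S + 1) mq Y2 := by
        rw [div_le_iff₀ (by norm_num : (0 : ℝ) < 144)]
        linarith [h2]

end Summit.QuantumFields.QCD.Theorems.StronglyChiralSubsequence

end
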